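import Summits.Ventures.HSemireg.WedgeHankelCoSiegelDecomposition
import Summits.Ventures.HSemireg.WedgeHankelFrameIdealBridge

/-!
# Venture HSemireg — THE SIEGEL IDEAL IS CUT OUT BY ANY `k + 1` FRAMES, IN EVERY DEGREE: `SI_k = ⋂_{i ≤ k} F_{λ_i}(k)` for ALL `1 ≤ k ≤ n`, and dually the
# co-Siegel space is the DIRECT sum of any `n − k′ + 1` pure images in EVERY degree `k′` — gen 14's `iInf_frameIdeal_eq_siegelIdeal` and F6's co-Siegel
# decomposition without the hypothesis `2k ≤ n`

HONEST FRAMING. Part of the Lean index of the computation cell `pub-hsemireg` (seat p10 gen 17, Sunday typer «UNIFORM-IN-n»).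
Finite-dimensional EXTERIOR ALGEBRA over a field ONLY: no variety, no cohomology theory, no sheaf, no Ext group, no semiregularity map;
nothing here says that HC / HC_CM / HC_AV holds; no Literature fact is declared or used.  Custodian versions as in `WedgeHankelSiegelIdeal` (1/3) and
`WedgeKernelDuality`; the dictionary (`plane(a,b) ↔ H^b(⋀^a T)`; the frame `{u^λ_a = x_a + λ y_a}` of the pure class `A·exp(λΘ)`, its volume `vol_λ = w_n(λ^•) =
Π_a u^λ_a`; `F_λ(k)` = the degree-`k` part of the ideal of the frame) is QUOTED, never asserted.

WHAT IS IN THE TREE.  Gen 14 D3 `WedgeHankelSecantSiegel.iInf_frameIdeal_eq_siegelIdeal`: `⋂_{i<r} F_{λ_i}(k) = SI_k` for `r ≥ k + 1` distinct slopes, `1 ≤ k` AND `2k ≤ n`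
(from the secant RANK law, which needs `k + 1 ≤ n + 1 − k`); gen 16 F2c `Kr_w_expMul_sum_eq_siegelIdeal` (one divisor class, `k + 1 ≤ D ≤ n + 1 − k`); F6
`coSiegel_eq_iSup_V_exp` (`2k ≤ n`).  In the MIRROR range `2k > n` a single class never has kernel `SI_k` (its Hankel rank is `≤ n + 1 − k < k + 1`), but the
INTERSECTION over `k + 1` frames still is `SI_k` — THIS FILE proves it for every `k ≤ n`, with no rank computation (namespace `Summit.Ventures.HSemireg.Wedge.KernelDuality`
continued; imports F6, E11):
* §86 **VANDERMONDE FOR MODULE ELEMENTS `eq_zero_of_forall_sum_pow_smul_eq_zero`**: `Σ_{a ≤ k} λ_i^a • u_a = 0` for `k + 1` distinct `λ_i` ⇒ every `u_a = 0` (duals separate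
  points; a polynomial of degree `≤ k` with `k + 1` roots vanishes).
* §87 **`prj_mul_vol`: the top-x-count component of `θ ∧ vol_λ` is `Σ_{a ≤ k} λ^a • (θ_a ∧ E_a)`** (`θ ∈ ⋀^k`, `k ≤ n`, `θ_a = prj a (k−a) θ`, `E_a = w_n(δ_a)`; E2/E3's
  expansion: `θ_a ∧ E_p ∈ plane(a + n − p, k − a + p)` has `n` x-letters iff `p = a`).
* §88 **`mem_siegelIdeal_of_forall_mul_vol_eq_zero`: a `θ ∈ ⋀^k` (`k ≤ n`) killed by `k + 1` distinct frame volumes `vol_{λ_0}, …, vol_{λ_k}` lies in `SI_k`** — §86 gives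
  `θ_a ∧ E_a = 0` for every `a`, and on the block `plane(a, k−a)` the power `E_a` has window `(1, 0, …)`, so gen 11's block law (`ker_wedgeP_of_window_ne`) makes `θ_a`
  isotropic.  Hence **`iInf_Kr_w_exp_eq_siegelIdeal`: `⋂_{i ≤ k} Kr(univ, w_n(A_i λ_i^•), k) = SI_k`** for every `k ≤ n`, and in gen 13's language
  **`iInf_frameIdeal_eq_siegelIdeal'`: `⋂_{i<r} F_{λ_i}(k) = SI_k` for every `1 ≤ k ≤ n` and every `r ≥ k + 1` distinct slopes** (D3 without `2k ≤ n`); `mem_siegelIdeal_iff_forall_mul_vol`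
  (membership form: `θ ∈ SI_k` iff `k + 1` distinct frame volumes kill it).
* §89 THE DUAL: **`coSiegel_eq_iSup_V_exp'`: `coSiegel(k′ + n) = ⨆_{i ≤ k} V(univ, w_n(A_i λ_i^•), k′)` for EVERY `k′` with `k + k′ = n`, and the sum is DIRECT**
  (`iSupIndep_V_w_exp'`) — every co-Siegel form is uniquely `Σ_{i ≤ k} θ_i ∧ (A_i vol_{λ_i})`, `θ_i ∈ ⋀^{k′}` modulo the frame; F6 had this for `2k ≤ n` only
  (E1's `Ann` of the intersection, `finrank_Ann_add`, `finrank_coSiegel`, F6's `finrank_V_w_exp`).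
NOT typed here: frames at `∞` among the `k + 1` (swap one slope to `∞` with E7's `Ψs`: the same statements with `F_∞(k)` / the point class, mechanical), confluent
frames (a node of order `P + 1` counted `P + 1` times: the intersection form of F2b in the mirror range — open); anything Ext-side.  Class side only; new names only.
-/

open Module

namespace Summit.Ventures.HSemireg.Wedge.KernelDuality

open Summit.Ventures.HSemireg.Wedge Summit.Ventures.HSemireg.Wedge.Kunneth Summit.Ventures.HSemireg.Wedge.Hankel
  Summit.Ventures.HSemireg.Wedge.HankelSiegel Summit.Ventures.HSemireg.Wedge.HankelSiegelIdeal Summit.Ventures.HSemireg.Wedge.KunnethKernel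
  Summit.Ventures.HSemireg.Wedge.HankelSecant Summit.Ventures.HSemireg.Wedge.HankelFrameChange Summit.Ventures.HSemireg.Wedge.HankelPureKernel

variable (K : Type*) [Field K] {n : ℕ}

/-! ## §86. Vandermonde for module elements -/

/-- **VANDERMONDE FOR MODULE ELEMENTS**: if `Σ_{a ≤ k} λ_i^a • u_a = 0` for `k + 1` pairwise distinct scalars `λ_0, …, λ_k`, then every `u_a = 0` (apply any linear functional:
the polynomial `Σ_a φ(u_a) X^a` of degree `≤ k` has the `k + 1` roots `λ_i`). -/
theorem eq_zero_of_forall_sum_pow_smul_eq_zero {M : Type*} [AddCommGroup M] [Module K M] {k : ℕ} {lam : Fin (k + 1) → K}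
    (hlam : Function.Injective lam) {u : Fin (k + 1) → M} (h : ∀ i, ∑ a : Fin (k + 1), lam i ^ (a : ℕ) • u a = 0) (a : Fin (k + 1)) :
    u a = 0 := by
  refine (Module.forall_dual_apply_eq_zero_iff K (u a)).mp fun φ => ?_
  set p : Polynomial K := ∑ b : Fin (k + 1), Polynomial.C (φ (u b)) * Polynomial.X ^ (b : ℕ) with hp
  have heval : ∀ i, p.eval (lam i) = 0 := by
    intro i
    have h1 := congrArg φ (h i)
    rw [map_sum, map_zero] at h1
    rw [hp, Polynomial.eval_finsetSum, ← h1]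
    refine Finset.sum_congr rfl fun b _ => ?_
    rw [Polynomial.eval_mul, Polynomial.eval_C, Polynomial.eval_pow, Polynomial.eval_X, map_smul, smul_eq_mul, mul_comm]
  have hdeg : p.natDegree < Fintype.card (Fin (k + 1)) := by
    rw [Fintype.card_fin]
    by_cases hp0 : p = 0
    · rw [hp0, Polynomial.natDegree_zero]; exact Nat.succ_pos k
    · exact (Polynomial.natDegree_lt_iff_degree_lt hp0).mpr (Polynomial.degree_sum_fin_lt fun b : Fin (k + 1) => φ (u b))
  have hz : p = 0 := Polynomial.eq_zero_of_natDegree_lt_card_of_eval_eq_zero p hlam heval hdeg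
  have hc : p.coeff (a : ℕ) = φ (u a) := by
    rw [hp, Polynomial.finsetSum_coeff, Finset.sum_eq_single a]
    · rw [Polynomial.coeff_C_mul_X_pow, if_pos rfl]
    · intro b _ hb
      rw [Polynomial.coeff_C_mul_X_pow, if_neg (fun h => hb (Fin.ext h.symm))]
    · intro h; exact absurd (Finset.mem_univ a) h
  rw [← hc, hz, Polynomial.coeff_zero]

/-! ## §87. The top-x-count component of `θ ∧ vol_λ` -/

/-- the pure class is a multiple of the frame volume: `w_n(A λ^•) = A • w_n(λ^•)` (`vol_λ := w_n(λ^•) = Π_a (x_a + λ y_a)`). -/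
lemma w_exp_eq_smul_vol (A lam : K) : w K n n (fun j => A * lam ^ j) = A • w K n n (fun j => lam ^ j) :=
  w_smul' K A n (fun j => lam ^ j)

/-- **THE TOP-x-COUNT COMPONENT OF `θ ∧ vol_λ`: `prj n k (θ ∧ w_n(λ^•)) = Σ_{a ≤ k} λ^a • (prj a (k−a) θ ∧ E_a)`** for `θ ∈ ⋀^k`, `k ≤ n` — in the expansion
`θ ∧ vol_λ = Σ_{a,p} λ^p θ_a ∧ E_p` the term `θ_a ∧ E_p ∈ plane(a + n − p, k − a + p)` has `n` x-letters exactly when `p = a`. -/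
theorem prj_mul_vol {k : ℕ} (hk : k ≤ n) (lam : K) {θ : HT K (In n)} (hθ : θ ∈ ⋀[K]^k (In n → K)) :
    prj K n n k (θ * w K n n (fun j => lam ^ j)) =
      ∑ a ∈ Finset.range (k + 1), lam ^ a • (prj K n a (k - a) θ * w K n n (fun j => if j = a then (1 : K) else 0)) := by
  have e : w K n n (fun j => lam ^ j) = w K n n (fun j => if j ≤ n then lam ^ j else 0) :=
    HankelRankOne.w_eq_of_agree K n fun i hi => by rw [if_pos hi]
  rw [e, mul_w_eq_sum_sum K (P := n) le_rfl (fun j hj => if_neg (by omega)) hθ, map_sum]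
  refine Finset.sum_congr rfl fun a ha => ?_
  rw [Finset.mem_range] at ha
  rw [map_sum, Finset.sum_eq_single a]
  · have hmem : prj K n a (k - a) θ * w K n n (fun j => if j = a then (1 : K) else 0) ∈ plane K n n k := by
      have := mul_w_spike_mem_plane K (p := a) (by omega) (prj_mem_plane K a (k - a) θ)
      rwa [show a + (n - a) = n by omega, show k - a + a = k by omega] at this
    rw [map_smul, prj_of_mem_plane K hmem]
    exact congrArg (· • _) (if_pos (by omega))
  · intro p hp hpa
    rw [Finset.mem_range] at hp
    rw [map_smul, prj_of_mem_plane_ne K (Or.inl (by omega)) (mul_w_spike_mem_plane K (by omega) (prj_mem_plane K a (k - a) θ)), smul_zero]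
  · intro h; exact absurd (Finset.mem_range.mpr (by omega)) h

/-! ## §88. A form killed by `k + 1` frame volumes is isotropic: the Siegel ideal is cut out by any `k + 1` frames -/

/-- **`θ ∈ ⋀^k` (`k ≤ n`) with `θ ∧ vol_{λ_i} = 0` for `k + 1` distinct `λ_i` lies in `SI_k`** — the top-x-count components give the Vandermonde system
`Σ_a λ_i^a (θ_a ∧ E_a) = 0`, so every `θ_a ∧ E_a = 0`, and `θ_a ∈ plane(a, k−a)` killed by `E_a` (window `(1, 0, …, 0)`) is isotropic by gen 11's block law. -/
theorem mem_siegelIdeal_of_forall_mul_vol_eq_zero {k : ℕ} (hk : k ≤ n) {lam : Fin (k + 1) → K} (hlam : Function.Injective lam)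
    {θ : HT K (In n)} (hθ : θ ∈ ⋀[K]^k (In n → K)) (h0 : ∀ i, θ * w K n n (fun j => lam i ^ j) = 0) : θ ∈ siegelIdeal K n k := by
  have hsys : ∀ i, ∑ a : Fin (k + 1), lam i ^ (a : ℕ) • (prj K n a (k - a) θ * w K n n (fun j => if j = (a : ℕ) then (1 : K) else 0)) = 0 := by
    intro i
    have h1 := congrArg (prj K n n k) (h0 i)
    rw [map_zero, prj_mul_vol K hk (lam i) hθ, Finset.sum_range] at h1
    exact h1
  have hua := eq_zero_of_forall_sum_pow_smul_eq_zero K hlam hsys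
  rw [← sum_prj K hθ]
  refine Submodule.sum_mem _ fun a ha => ?_
  rw [Finset.mem_range] at ha
  have hE : prj K n a (k - a) θ * w K n n (fun j => if j = a then (1 : K) else 0) = 0 := hua ⟨a, ha⟩
  have hker : (⟨prj K n a (k - a) θ, prj_mem_plane K a (k - a) θ⟩ : plane K n a (k - a)) ∈
      LinearMap.ker (wedgeP K n a (k - a) (fun j => if j = a then (1 : K) else 0)) := by
    rw [LinearMap.mem_ker, wedgeP, LinearMap.comp_apply, Submodule.subtype_apply, LinearMap.mulRight_apply]; exact hE
  rw [ker_wedgeP_of_window_ne K (s := 0) (Nat.zero_le _) (by rw [Nat.add_zero, if_pos rfl]; exact one_ne_zero),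
    Submodule.mem_comap, Submodule.subtype_apply, show a + (k - a) = k by omega] at hker
  exact hker

/-- the pure class of slope `λ` kills exactly what its frame volume kills: `θ ∧ w_n(A λ^•) = 0 ↔ θ ∧ vol_λ = 0` (`A ≠ 0`). -/
lemma mul_w_exp_eq_zero_iff {A : K} (hA : A ≠ 0) (lam : K) (θ : HT K (In n)) :
    θ * w K n n (fun j => A * lam ^ j) = 0 ↔ θ * w K n n (fun j => lam ^ j) = 0 := by
  rw [w_exp_eq_smul_vol, mul_smul_comm, smul_eq_zero]
  exact ⟨fun h => h.resolve_left hA, Or.inr⟩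

/-- **THE SIEGEL IDEAL IS CUT OUT BY ANY `k + 1` PURE CLASSES, IN EVERY DEGREE `k ≤ n`: `⋂_{i ≤ k} Kr(univ, w_n(A_i λ_i^•), k) = SI_k`** for pairwise distinct `λ_i` and
`A_i ≠ 0` — no hypothesis `2k ≤ n` (gen 14 D3 / gen 16 F2c reach `SI_k` from rank computations that need `k + 1 ≤ n + 1 − k`). -/
theorem iInf_Kr_w_exp_eq_siegelIdeal {k : ℕ} (hk : k ≤ n) {lam : Fin (k + 1) → K} (hlam : Function.Injective lam) {A : Fin (k + 1) → K}
    (hA : ∀ i, A i ≠ 0) : (⨅ i, Kr K Finset.univ (w K n n (fun j => A i * lam i ^ j)) k) = siegelIdeal K n k := by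
  refine le_antisymm (fun θ hθ => ?_) (le_iInf fun i => siegelIdeal_le_Kr_w K n k _)
  rw [Submodule.mem_iInf] at hθ
  have hθk : θ ∈ ⋀[K]^k (In n → K) := by
    have := (mem_Kr.mp (hθ 0)).1; rwa [Hom_univ_eq_exteriorPower] at this
  exact mem_siegelIdeal_of_forall_mul_vol_eq_zero K hk hlam hθk fun i => (mul_w_exp_eq_zero_iff K (hA i) (lam i) θ).mp (mem_Kr.mp (hθ i)).2

/-- the same for ANY `r ≥ k + 1` distinct slopes: the first `k + 1` already cut out `SI_k`, which lies in every pure kernel. -/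
theorem iInf_Kr_w_exp_eq_siegelIdeal_of_le {k r : ℕ} (hk : k ≤ n) (hkr : k + 1 ≤ r) {lam : Fin r → K} (hlam : Function.Injective lam) {A : Fin r → K}
    (hA : ∀ i, A i ≠ 0) : (⨅ i, Kr K Finset.univ (w K n n (fun j => A i * lam i ^ j)) k) = siegelIdeal K n k := by
  refine le_antisymm ?_ (le_iInf fun i => siegelIdeal_le_Kr_w K n k _)
  rw [← iInf_Kr_w_exp_eq_siegelIdeal K hk (lam := lam ∘ Fin.castLE hkr) (hlam.comp (Fin.castLE_injective hkr)) (A := A ∘ Fin.castLE hkr)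
    (fun i => hA _)]
  exact le_iInf fun i => iInf_le _ (Fin.castLE hkr i)

/-- **IN GEN 13's LANGUAGE: `⋂_{i<r} F_{λ_i}(k) = SI_k` for every `1 ≤ k ≤ n` and every `r ≥ k + 1` pairwise distinct slopes** — D3's `iInf_frameIdeal_eq_siegelIdeal` without
the hypothesis `2k ≤ n` (E11's bridge `F_λ(k) = Φs λ (xRich(k, 0)) = Kr(univ, w_n(λ^•), k)`). -/
theorem iInf_frameIdeal_eq_siegelIdeal' {k r : ℕ} (hk1 : 1 ≤ k) (hk : k ≤ n) (hkr : k + 1 ≤ r) {lam : Fin r → K} (hlam : Function.Injective lam) :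
    (⨅ i, frameIdeal K n (uvec K n (lam i)) k) = siegelIdeal K n k := by
  have e : ∀ i, frameIdeal K n (uvec K n (lam i)) k = Kr K Finset.univ (w K n n (fun j => (1 : K) * lam i ^ j)) k := fun i => by
    rw [Kr_w_exp_eq K hk (lam i) one_ne_zero, map_Φs_xRich_zero_eq_frameIdeal K (lam i) hk1 hk]
  simp only [e]
  exact iInf_Kr_w_exp_eq_siegelIdeal_of_le K hk hkr hlam (fun _ => one_ne_zero)

/-- a degree-`k` form lies in the Siegel ideal iff it is killed by `k + 1` frame volumes of distinct slopes (membership form of §88; `k ≤ n`). -/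
theorem mem_siegelIdeal_iff_forall_mul_vol {k : ℕ} (hk : k ≤ n) {lam : Fin (k + 1) → K} (hlam : Function.Injective lam) {θ : HT K (In n)}
    (hθ : θ ∈ ⋀[K]^k (In n → K)) : θ ∈ siegelIdeal K n k ↔ ∀ i, θ * w K n n (fun j => lam i ^ j) = 0 :=
  ⟨fun h _ => mul_w_eq_zero_of_mem_siegelIdeal K h _, mem_siegelIdeal_of_forall_mul_vol_eq_zero K hk hlam hθ⟩

/-! ## §89. The dual: the co-Siegel space is the direct sum of any `k + 1` pure images, in every degree -/

/-- every image of a `K[Θ]`-class lies in the co-Siegel space: `V(univ, w_n(q), k′) ≤ coSiegel(k′ + n)` (`k + k′ = n`; dual to `SI_k ≤ Kr(univ, w_n(q), k)`). -/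
lemma V_w_le_coSiegel {k k' : ℕ} (hkk' : k + k' = n) (q : ℕ → K) : V K (In n) Finset.univ (w K n n q) k' ≤ coSiegel K n (k' + n) := by
  rw [V_w_eq_Ann K hkk', ← Ann_siegelIdeal K (show k + (k' + n) = n + n by omega)]
  exact Ann_anti K _ (siegelIdeal_le_Kr_w K n k q)

/-- the dimension of a finite sum of subspaces is at most the sum of the dimensions (private; generic). -/
private theorem finrank_finset_sup_le' {M : Type*} [AddCommGroup M] [Module K M] [FiniteDimensional K M] {ι : Type*} (s : Finset ι)
    (F : ι → Submodule K M) : finrank K ↥(s.sup F) ≤ ∑ i ∈ s, finrank K (F i) := by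
  classical
  induction s using Finset.induction_on with
  | empty => rw [Finset.sup_empty, finrank_bot, Finset.sum_empty]
  | insert a s ha ih =>
    rw [Finset.sup_insert, Finset.sum_insert ha]
    exact (Submodule.finrank_add_le_finrank_add_finrank _ _).trans (Nat.add_le_add_left ih _)

/-- the annihilator of the sum of the pure images is the intersection of the pure kernels (E1: `Kr = Ann V`, `Ann` of a sum). -/
lemma Ann_iSup_V_w_eq_iInf_Kr {k k' r : ℕ} (hkk' : k + k' = n) (hr : 0 < r) (q : Fin r → ℕ → K) :
    Ann K k (⨆ i, V K (In n) Finset.univ (w K n n (q i)) k') = ⨅ i, Kr K Finset.univ (w K n n (q i)) k := by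
  ext θ
  rw [mem_Ann_iSup_iff, Submodule.mem_iInf]
  constructor
  · rintro ⟨hθk, h⟩ i
    rw [Kr_w_eq_Ann K hkk']
    exact mem_Ann.mpr ⟨hθk, h i⟩
  · intro h
    have h0 := h ⟨0, hr⟩
    rw [Kr_w_eq_Ann K hkk'] at h0
    refine ⟨(mem_Ann.mp h0).1, fun i v hv => ?_⟩
    have hi := h i
    rw [Kr_w_eq_Ann K hkk'] at hi
    exact (mem_Ann.mp hi).2 v hv

/-- **THE CO-SIEGEL SPACE IS THE SUM OF ANY `k + 1` PURE IMAGES, IN EVERY DEGREE: `coSiegel(k′ + n) = ⨆_{i ≤ k} V(univ, w_n(A_i λ_i^•), k′)`** for `k + k′ = n`,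
pairwise distinct `λ_i`, `A_i ≠ 0` — every degree-`(n + k′)` form killed by all Siegel 2-vectors is `Σ_{i ≤ k} θ_i ∧ (A_i · vol_{λ_i})` with `θ_i ∈ ⋀^{k′}`; F6's
`coSiegel_eq_iSup_V_exp` needed `2k ≤ n` (i.e. `k′ ≥ n/2`). -/
theorem coSiegel_eq_iSup_V_exp' {k k' : ℕ} (hkk' : k + k' = n) {lam : Fin (k + 1) → K} (hlam : Function.Injective lam) {A : Fin (k + 1) → K}
    (hA : ∀ i, A i ≠ 0) : coSiegel K n (k' + n) = ⨆ i, V K (In n) Finset.univ (w K n n (fun j => A i * lam i ^ j)) k' := by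
  have hle : (⨆ i, V K (In n) Finset.univ (w K n n (fun j => A i * lam i ^ j)) k') ≤ coSiegel K n (k' + n) :=
    iSup_le fun i => V_w_le_coSiegel K hkk' _
  have hAnn : Ann K k (⨆ i, V K (In n) Finset.univ (w K n n (fun j => A i * lam i ^ j)) k') = siegelIdeal K n k := by
    rw [Ann_iSup_V_w_eq_iInf_Kr K hkk' (Nat.succ_pos k), iInf_Kr_w_exp_eq_siegelIdeal K (show k ≤ n by omega) hlam hA]
  symm
  refine Submodule.eq_of_le_of_finrank_eq hle ?_
  have h1 := finrank_Ann_add K (a := k) (b := k' + n) (I := In n) (by rw [Fintype.card_fin]; omega) (hle.trans (coSiegel_le_Hom K (k' + n)))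
  rw [hAnn, Fintype.card_fin] at h1
  have h2 := finrank_siegelIdeal K (n := n) k
  rw [finrank_coSiegel K (show k + (k' + n) = n + n by omega)]
  omega

/-- the total dimension: `dim ⨆_{i ≤ k} V(univ, w_n(A_i λ_i^•), k′) = (k + 1)·C(n, k) = Σ_i dim V_i` (each pure image has dimension `C(n, k′) = C(n, k)`). -/
theorem finrank_iSup_V_w_exp' {k k' : ℕ} (hkk' : k + k' = n) {lam : Fin (k + 1) → K} (hlam : Function.Injective lam) {A : Fin (k + 1) → K}
    (hA : ∀ i, A i ≠ 0) :
    finrank K ↥(⨆ i, V K (In n) Finset.univ (w K n n (fun j => A i * lam i ^ j)) k') =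
      ∑ i : Fin (k + 1), finrank K (V K (In n) Finset.univ (w K n n (fun j => A i * lam i ^ j)) k') := by
  rw [← coSiegel_eq_iSup_V_exp' K hkk' hlam hA, finrank_coSiegel K (show k + (k' + n) = n + n by omega)]
  rw [Finset.sum_congr rfl fun i _ => finrank_V_w_exp K hkk' (lam i) (hA i), Finset.sum_const, Finset.card_univ, Fintype.card_fin, smul_eq_mul]

/-- **… AND THE SUM IS DIRECT**: `iSupIndep (i ↦ V(univ, w_n(A_i λ_i^•), k′))` in every degree `k′` (`k + k′ = n`, distinct `λ_i`, `A_i ≠ 0`) — dimension count. -/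
theorem iSupIndep_V_w_exp' {k k' : ℕ} (hkk' : k + k' = n) {lam : Fin (k + 1) → K} (hlam : Function.Injective lam) {A : Fin (k + 1) → K}
    (hA : ∀ i, A i ≠ 0) : iSupIndep (fun i => V K (In n) Finset.univ (w K n n (fun j => A i * lam i ^ j)) k') := by
  classical
  set F : Fin (k + 1) → Submodule K (HT K (In n)) := fun i => V K (In n) Finset.univ (w K n n (fun j => A i * lam i ^ j)) k' with hF
  have htot : finrank K ↥(⨆ i, F i) = ∑ i, finrank K (F i) := finrank_iSup_V_w_exp' K hkk' hlam hA
  intro i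
  have hrest_eq : (⨆ (j) (_ : j ≠ i), F j) = (Finset.univ.erase i).sup F := by
    rw [Finset.sup_eq_iSup]
    refine iSup_congr fun j => ?_
    by_cases hj : j = i
    · subst hj; simp
    · simp [hj]
  have hrest : finrank K ↥(⨆ (j) (_ : j ≠ i), F j) ≤ ∑ j ∈ Finset.univ.erase i, finrank K (F j) := by
    rw [hrest_eq]; exact finrank_finset_sup_le' K _ F
  have hsplit : (⨆ j, F j) = F i ⊔ ⨆ (j) (_ : j ≠ i), F j := by
    apply le_antisymm
    · refine iSup_le fun j => ?_
      by_cases hj : j = i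
      · subst hj; exact le_sup_left
      · exact (le_iSup₂ (f := fun j (_ : j ≠ i) => F j) j hj).trans le_sup_right
    · exact sup_le (le_iSup F i) (iSup₂_le fun j _ => le_iSup F j)
  have hsum : ∑ j, finrank K (F j) = finrank K (F i) + ∑ j ∈ Finset.univ.erase i, finrank K (F j) :=
    (Finset.add_sum_erase _ _ (Finset.mem_univ i)).symm
  have hdim := Submodule.finrank_sup_add_finrank_inf_eq (F i) (⨆ (j) (_ : j ≠ i), F j)
  rw [← hsplit, htot, hsum] at hdim
  have h0 : finrank K ↥(F i ⊓ ⨆ (j) (_ : j ≠ i), F j) = 0 := by omega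
  rw [disjoint_iff, Submodule.finrank_eq_zero.mp h0]

/-- the degree-`0` image of a class is the line it spans: `V(univ, f, 0) = K ∙ f` (`E_∅ = 1`). -/
lemma V_univ_zero (f : HT K (In n)) : V K (In n) Finset.univ f 0 = K ∙ f := by
  rw [V]
  congr 1
  ext x
  simp only [Set.mem_image, Set.mem_setOf_eq, Finset.card_eq_zero, Set.mem_singleton_iff]
  constructor
  · rintro ⟨s, ⟨-, rfl⟩, rfl⟩; rw [B_empty, one_mul]
  · rintro rfl; exact ⟨∅, ⟨Finset.empty_subset _, rfl⟩, by rw [B_empty, one_mul]⟩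

/-- the degree-`n` case `k′ = 0`: **`coSiegel(n) = ⨁_{i ≤ n} K · vol_{λ_i}` for any `n + 1` distinct slopes** — th-7's `n + 1` classes `w_n(δ_p)` (F9's basis of `coSiegel(n)`)
replaced by any `n + 1` frame volumes `vol_λ = Π_a (x_a + λ y_a)`. -/
theorem coSiegel_n_eq_iSup_span_vol {lam : Fin (n + 1) → K} (hlam : Function.Injective lam) :
    coSiegel K n n = ⨆ i, K ∙ w K n n (fun j => lam i ^ j) := by
  have h := coSiegel_eq_iSup_V_exp' K (n := n) (k := n) (k' := 0) (Nat.add_zero n) hlam (A := fun _ => (1 : K)) (fun _ => one_ne_zero)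
  rw [Nat.zero_add] at h
  rw [h]
  refine iSup_congr fun i => ?_
  rw [V_univ_zero, show (fun j => (1 : K) * lam i ^ j) = fun j => lam i ^ j from funext fun j => one_mul _]

end Summit.Ventures.HSemireg.Wedge.KernelDuality
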